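import Literature.MathematicalPhysics.QuantumFieldTheory.Balaban1983to89.B9Ineq349SiteSchemasR
import Literature.MathematicalPhysics.QuantumFieldTheory.Balaban1983to89.B9B8AveragingJunction

/-!
# `Balaban1983to89.B9Ineq349SiteFacesAtLettersRLaws` — T. Bałaban, *Propagators for lattice gauge theories in a background field*, Commun. Math. Phys.
# **99** (1985) 389–434 [Balaban1985BackgroundPropagators], (3.49) p. 399 ⇐ Thm 3.1 (3.42) p. 397 + Thm 3.2 (3.48) p. 398: ROW 25's FACE
# `s349_site_of_t37_display348_of_R` RE-PRESSED ONCE WITH THE SITE TRANSPORTER's TWO LAWS DISPLAYED ON THE REGIME (instead of the two pins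
# `parS = parSymY`, `Gp = GpY parSymY`) — and KEYED TO PRINT's KNIT AVERAGING CONTOURS `parKnitY` ([5] Prop. 2), the `s349K` binder of the
# N06 certificate at the knit letters (`BalabanUVNodes.N06AtOpsYSectEStKnitPairKA` … `…KnitRecordKE6X`) in ONE call

[4] = T. Bałaban, *Propagators and renormalization transformations for lattice gauge theories. II*, Commun. Math. Phys. **96** (1984) 223–250 [`Balaban1984PropagatorsII`];
[5] = T. Bałaban, *Averaging operations for lattice gauge theories*, Commun. Math. Phys. **98** (1985) 17–51 [`Balaban1985Averaging`].

statement-level skeleton of published theorems with citation tags; proofs where landed; nothing here is a claim about the Yang–Mills mass gap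

THE PRINT.  [B9] p. 399: *«Let us consider the operator P = I − R. We have ∇_U P_U = −∇_U R_U, hence using again Lemma 2.1 of [4] we get
|(∇_U^β P_U)(U, x, x′)| ≦ O(1)(L^{j₀}η)^{−d−1−|β|} exp(−δ(L^{j₀}η)⁻¹|x − x′|) (3.49)»*; p. 397 Thm 3.1 (3.42); p. 398 Thm 3.2 (3.48); p. 410 *«Theorem 3.7 implies
… (3.42)–(3.47)»*; p. 413 *«This theorem [3.9] implies Theorem 3.2»*; p. 394 (3.24)–(3.25) (`Δ′_a(U)` symmetric positive, `G′ = (Δ′_a)⁻¹`, `R = G′Q′*a`); p. 396 (3.35)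
*«U with values in G»*; p. 393 (3.19) (the averaging contours inside `Q′`); [5] Prop. 2 p. 26 (the knit contours `Γ`, `U(Γ)` in `G` on the class (52)).

WHY THIS FILE (dag-n06-c gen 30; dag-n06-d g27 FINAL STATE «LEFT DISPLAYED in the head: `s349K` (row 25 — needs a knit∕par site reader twin of n06-i's
`s349_site_…_of_t37_display348`; none in tree)»).  dag-n06-i's one-call reader `B9Ineq349SiteFacesAtLettersR.s349_site_of_t37_display348_of_R` derives the printed
(3.49) from ROW 18's Theorem-3.7 leaf and ROWS 15–16's one display `(3.48)⁻¹` for a letters family PINNED to def-Y's symmetrised transporter: `(𝔏 x).parS = parSymY`,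
`(𝔏 x).Gp = GpY (parSymY)`.  The knit letters of record (`Node00.OpsYRecordV11.lettersYOfRecordV11K`, `lettersYOfRecordV11_base`) have `parS = parKnitY` and
`Gp = GpY (parKnitY)` — print's own averaging contours — so the pinned reader does not apply and the head certificate `…KnitRecordKE6X` still DISPLAYS `s349K`.
The two pins are read in exactly two places of n06-i's chain: (a) `B9Ineq349SiteSchemasR.thm31LeftSchemaR_of_majorants` turns `G`-membership of the transporter
values into CONTRACTIVITY (`‖par‖, ‖par⁻¹‖ ≤ 1`) for the LEFT (3.42) schema; (b) `thm31LeftSchemaSymmR_of_std` supplies the trace-SYMMETRY of `G′(U)` and the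
membership of the transporter values, which `thm31SiteSchemasR_of_leftSymm` reads only as UNITARITY (adjoint side `right342At_of_left342At`).  For the knit contours
both facts hold — but ON THE REGIME and below a plaquette threshold only (the knit legs are unitary by [5] Prop. 2 on the class (52):
`BalabanUVNodes.N06WalkLettersAtRecordROPar.laws_parKnitY_of_reg335P`; `Δ′_a(U; parKnitY)` is symmetric for unitary legs: dag-n06-l's `symm0_parKnitY` =
`B9Thm311DeltaPrimeSymm.deltaPrimeAY_isSymmTr_of_inv_symm` at `parKnitY_inv`), which is all the chain ever uses: every schema is itself quantified over
`M ≥ M₁, 0 < α₀, M·α₀ ≤ a₀, U ∈ (3.35)`.  THIS FILE re-presses (a) and (b) with the two pins REPLACED by ONE displayed LAW of the same quantifier shape,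
`hlawS : ∀ x α₀, 0 < α₀ → M·α₀ ≤ aK → ∀ U ∈ (3.35)_{c35,α₀}, (∀ z w, (𝔏 x).parS U z w ∈ U(N)) ∧ G′(U) trace-symmetric` (the schema threshold shrinks to
`min a₀ aK`), and then keys the one-call reader to the knit letters in the binder currency of the certificate skeleton `…KnitPairKA` (its internal law
`hlawK … .1`, its `h348` display at `L = Q′(parKnitY)G′²Q′*(parKnitY)`, its leaf `t37′`).

WHAT IS PROVED (sorry-free, 0 def; `𝔸 = M_N(ℂ)`).
* §1 `thm31LeftSchemaR_of_majorants_lawU` ∕ `thm31LeftSchemaR_of_t37_lawU` (any `G`) — the LEFT (3.42) schema at the carrier from the two sup majorants ∕ from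
  ROW 18's leaf of Theorem 3.7 on ANY expansion family `E` whose convergence yields `Conv342 (𝔬 x) (R x) (H x) C δ` (`hconv`; n06-i's `majorants_of_thm37Printed_R`),
  under the thresholded UNITARITY law of the letters' site transporter (n06-i's proofs with `contractive_of_mem` read in `U(N)`; threshold `min a₀ aK`).
* §2 `thm31LeftSchemaSymmR_of_lawS` (LEFT → LEFT ∧ symmetric ∧ unitary legs, threshold `min a₀ aK`), ★ `thm31SiteSchemasR_of_leftSymmU (hG : G ≤ U(N)) (hGR)`
  (n06-i's `thm31SiteSchemasR_of_leftSymm` with the membership conjunct read in `U(N)`; same constant `max 1 N · B₀`), ★★ `thm31SiteSchemasR_of_t37_lawS` (§1 + §2).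
* §3 ★★★ `s349_site_of_t37_display348_of_R_lawS (R₁ R₂) (hGR) θ M⋆ 𝔏 b hlev hβ1 hnbr 𝔬 rd H hp t37 hblkS hblkYS hGpS hDS haK hlawS hc hB hδ ha₁ hM₁ h348` — ROW 25 OF THE
  R-GENERIC CERTIFICATE IN ONE CALL for ANY letters family whose transporter obeys the displayed law (n06-i's `…_of_R` with `hparS hGp ↦ haK hlawS`, otherwise
  the same binders in the same order — leaf on the `PairM` E-letter — and the same conclusion `B9.Stmt349Printed (d+1) c35 geo9Y (bg9YR … R₁ R₂) (x ↦ fineKernelR R₁ R₂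
  (p349SiteY … x (𝔏 x)))`).
* §4 `majorants348_of_display348_R_at` (ROWS 15–16's display with the averaging transporter of `L` EXPLICIT, `parA`, at letters with `(𝔏 x).parS = parA x`, over the
  `bg9YR`-typed one-cube ops — the shape of `B9Thm39FacesAtLettersRCPar` and of the knit skeleton's `h348`), ★★★ `s349_site_of_t37_display348_of_R_knit` — ROW 25
  KEYED TO THE KNIT LETTERS: pins `(𝔏 x).parS = parKnitY`, `(𝔏 x).Gp = GpY (parKnitY)`; leaf on ANY `E` with `hconv` (the skeleton's `t37'` lives on
  `E37YPairMDir …`); law input = unitarity of the knit legs on the regime below `aK` (the skeleton's `hlawK … .1` verbatim); the symmetry of `G′(U; parKnitY)` is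
  DERIVED (`isSymmTr_ringInverse ∘ deltaPrimeAY_isSymmTr_of_inv_symm` at `parKnitY_inv`, `U` unitary by `mem_of_reg335R hGR`); `h348` in the skeleton's currency.

CONSUMER RECIPE (dag-n06-d, the next KA-body edition; names as in `…KnitPairKA`'s proof; kernel-checked here on a scratch twin of the call, default heartbeats).
With ONE new letter pin `(h𝔏S : ∀ x, (𝔏 x).parS = parKnitY x.toKIdx)` (closed by `rfl` at `lettersYOfRecordV11K … 𝔯`, `Node00.OpsYRecordV11.lettersYOfRecordV11_base`):
`have s349K := s349_site_of_t37_display348_of_R_knit θ.toStage3Params Mstar R₁ R₂ hGR 𝔏 h𝔏S h𝔏Gp (trBasis N) hlev hβ1 (hnbr_two_of_le hM₀) 𝔬 t37'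
(R := fun _ => (1 : ℝ)) (H := H) (p.C_nonneg hp _) (PinPrims.rate_pos hp) (fun _ _ h => h.1) hblkS hblkYS (fun x U => by rw [h𝔏Gp x]) hDS
(lt_of_lt_of_le (div_pos hp.a₁_pos hc) hpaK) (fun x α₀ hα ha U hU => (hlawK x α₀ hα ha U hU).1) hc hB39.le (hr39.trans_le hrδ39) ha39 hM39 h348` — its type IS the
displayed binder `s349K : B9.Stmt349Printed (d+1) c geo9Y (bg9YR … R₁ R₂) (x ↦ fineKernelR R₁ R₂ ((opsYSectESt … (opsYS349NuOfLettersH … 𝔏 (parSymY ·) 𝔈) 𝔏 … ) x).P349)`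
by `rfl` (`Node00.OpsYRecordV11SH.opsYS349NuOfLettersH_P349`, `p349SiteY`).

HONEST SCOPE.  Re-press bookkeeping of LANDED derivations (n06-i gen 21 ∕ CASCADE-R) with two pins replaced by one displayed law of printed species; the law, ROW
18's leaf and ROWS 15–16's display remain HYPOTHESES; nothing of [B9], [4] or [5] is asserted; count-neutral; N06 NOT discharged; one finite 𝕋^{d+1} programme at
fixed ε — nothing continuum, nothing OS, nothing about the mass gap.  Cell `pub-ymgap` (HUMAN RULING D-0062), Track A node N06 [B9], seat `pub-ymgap-dag-n06-c`
(gen 30), 2026-08-31; a NEW file (APPEND-ONLY companion of `B9Ineq349SiteSchemasR` ∕ `B9Ineq349SiteFacesAtLettersR`, untouched, consumed by name).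
-/

noncomputable section

namespace Literature.MathematicalPhysics.QuantumFieldTheory.Balaban1983to89.B9Ineq349SiteFacesAtLettersRLaws

open B6RandomWalk (HasMajorant)
open B6RandomWalkHom (HasMajorantHom)
open B6GlobalChartV1 (blkV1)
open B6Ineq2142KLevelV1 (lvl β)
open B9Thm34Ext (toB6)
open B9Thm37Whole (Ops)
open B9Cor38Whole (WalkReading)
open B9Thm39WholeBlk (Conv348Blk)
open B9Thm39ReadingAtLetters (X39 L39)
open B9Thm39OneCubeReadingAtLettersY (oneCubeOps39 oneCubeOps39YF)
open B9CoReadingCoordsS (XSK blkSK sIK GcoS DcoS)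
open B9Ineq349SiteReading (p349SiteY)
open B9Ineq349SiteComposite (lenB lenB_pos Left342At Right342At)
open B9Ineq349SiteFromBlocksR (Thm31SiteSchemasR stmt349Printed_site_of_blockSchemas_R)
open B9Ineq349SiteAdjoint (right342At_of_left342At isSymmTr_ringInverse)
open B9Ineq349SiteFromConv342 (left342At_of_hasMajorants left342At_mono contractive_of_mem)
open B9Ineq349SiteFromConv348 (blk39F)
open B9Ineq349SiteSchemasR (majorants_of_thm37Printed_R thm32BlkSchemaR_of_majorants thm32BlkSchemaR_of_display348)
open B9Thm311ReadingCoords (IsSymmTr)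
open B9Thm311DeltaPrimeSymm (deltaPrimeAY_isSymmTr_of_inv_symm)
open B9B8AveragingJunction (parKnitY parKnitY_inv)
open B9RWSumsDefinitePins (PinPrims)
open B9RWSumsDefinitePinsPair (PairPrims)
open B9RWSumsDefinitePinsPairM (MixedPrims E37YPairM)
open B7Prop2Explicit (unitaryUnits)
open B7Prop2SpecialUnitary (specialUnitaryUnits specialUnitaryUnits_le_unitaryUnits)
open B9PinMembersKLevelV1 (MemberY geo9Y bg9Y)
open B9BackgroundsKLevelV1R (RegFamY bg9YR fineKernelR MemOfFam mem_of_reg335R)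
open B9RWSumsReadsNbr (nbr)
open Node00
open scoped Matrix.Norms.L2Operator

/-! ## §1 The LEFT (3.42) schema at the carrier under the thresholded unitarity law of the letters' site transporter -/

section Left

variable {N : ℕ} {G : Subgroup (Matrix (Fin N) (Fin N) ℂ)ˣ} {κ : Type} [Fintype κ] [DecidableEq κ]
variable {d ℓ : ℕ} {hd : 1 ≤ d + 1} {hL : Odd (ℓ + 1) ∧ 1 < ℓ + 1} {b₀ b₁ : ℝ} {Mstar : ℕ}
variable [∀ x : MemberY d ℓ hd hL b₀ b₁ Mstar, Fintype (geo9Y x).Site]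
variable (R₁ R₂ : RegFamY d ℓ hd hL b₀ b₁ Mstar (Matrix (Fin N) (Fin N) ℂ))

/-- **THE LEFT (3.42) SCHEMA AT THE CLASS-PARAMETRIC CARRIER FROM THE TWO SUP MAJORANTS, UNDER THE UNITARITY LAW OF THE SITE TRANSPORTER** — n06-i's
`thm31LeftSchemaR_of_majorants` with its `hparG` (membership for every `G`-valued configuration) REPLACED by the thresholded law on the regime
`hparU : M·α₀ ≤ aK → U ∈ (3.35) → (𝔏 x).parS U z w ∈ U(N)` (what print has for the knit contours, [5] Prop. 2); the transporter values are then contractive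
(`contractive_of_mem` in `U(N)`), the schema threshold becomes `min a₀ aK`, constant `max(1, mN·C·e^{2δ})`; class-blind otherwise.
[cite: Balaban1985BackgroundPropagators, Thm 3.1 (3.42) p.397 ⇐ Thm 3.7 p.410; (3.19) p.393, (3.25) p.394, (3.35) p.396; Balaban1985Averaging, Prop. 2 p.26] -/
theorem thm31LeftSchemaR_of_majorants_lawU
    (b : Module.Basis κ ℝ (Matrix (Fin N) (Fin N) ℂ)) {c35 : ℝ} (𝔏 : ∀ x : MemberY d ℓ hd hL b₀ b₁ Mstar, CovLettersY (Matrix (Fin N) (Fin N) ℂ) x)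
    {aK : ℝ} (haK : 0 < aK)
    (hparU : ∀ (x : MemberY d ℓ hd hL b₀ b₁ Mstar) (α₀ : ℝ), 0 < α₀ → (geo9Y x).M * α₀ ≤ aK →
      ∀ U : (bg9YR (Matrix (Fin N) (Fin N) ℂ) G R₁ R₂ x).Cfg, (bg9YR (Matrix (Fin N) (Fin N) ℂ) G R₁ R₂ x).Reg335 c35 α₀ U →
        ∀ z w : SiteY x.toKIdx, (𝔏 x).parS U z w ∈ unitaryUnits (Matrix (Fin N) (Fin N) ℂ))
    {bI : ∀ x : MemberY d ℓ hd hL b₀ b₁ Mstar, FBondY x.toKIdx → IBondY x.toKIdx}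
    (hlev : ∀ (x : MemberY d ℓ hd hL b₀ b₁ Mstar) (f : FBondY x.toKIdx), lvl x.hN x.D x.hk (bI x f) = (blkV1 x.hN x.D f).1.1)
    (hβ1 : ∀ (x : MemberY d ℓ hd hL b₀ b₁ Mstar) (f : FBondY x.toKIdx), (B6Geom246MultiLevelTorus.geomT x.D).dist (β x.hN x.D x.hk (bI x f)) (blkV1 x.hN x.D f) ≤ 1)
    {mN : ℕ} (hnbr : ∀ (x : MemberY d ℓ hd hL b₀ b₁ Mstar) (y : (geo9Y x).Site), (nbr (geo9Y x) 2 y).card ≤ mN)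
    {R : MemberY d ℓ hd hL b₀ b₁ Mstar → ℝ} {H : MemberY d ℓ hd hL b₀ b₁ Mstar → Prop}
    (h : ∃ M₂ a₀ C δ : ℝ, 0 < M₂ ∧ 0 < a₀ ∧ 0 ≤ C ∧ 0 < δ ∧
      ∀ x : MemberY d ℓ hd hL b₀ b₁ Mstar, M₂ ≤ (geo9Y x).M → ∀ α₀ : ℝ, 0 < α₀ → (geo9Y x).M * α₀ ≤ a₀ →
        ∀ U : (bg9YR (Matrix (Fin N) (Fin N) ℂ) G R₁ R₂ x).Cfg, (bg9YR (Matrix (Fin N) (Fin N) ℂ) G R₁ R₂ x).Reg335 c35 α₀ U →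
          HasMajorant (g := toB6 (geo9Y x) (R x) (H x)) (blkSK x.toKIdx (sIK x.toKIdx (bI x)))
              (GcoS x.toKIdx b (bg9YR (Matrix (Fin N) (Fin N) ℂ) G R₁ R₂ x) (fun U => U) (𝔏 x).Gp U)
              (fun a a' => C * (geo9Y x).len a ^ 2 * Real.exp (-(δ * (geo9Y x).dist a a'))) ∧
            HasMajorantHom (g := toB6 (geo9Y x) (R x) (H x)) (blkSK x.toKIdx (sIK x.toKIdx (bI x))) (blkSK x.toKIdx (sIK x.toKIdx (bI x)))
              (DcoS x.toKIdx b (bg9YR (Matrix (Fin N) (Fin N) ℂ) G R₁ R₂ x) (fun U => U) U ∘ₗ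
                GcoS x.toKIdx b (bg9YR (Matrix (Fin N) (Fin N) ℂ) G R₁ R₂ x) (fun U => U) (𝔏 x).Gp U)
              (fun a a' => C * (geo9Y x).len a * Real.exp (-(δ * (geo9Y x).dist a a')))) :
    ∃ M₁ δ₀ a₀ B₀ : ℝ, 0 < M₁ ∧ 0 < δ₀ ∧ 0 < a₀ ∧ 0 < B₀ ∧
      ∀ x : MemberY d ℓ hd hL b₀ b₁ Mstar, M₁ ≤ (geo9Y x).M → ∀ α₀ : ℝ, 0 < α₀ → (geo9Y x).M * α₀ ≤ a₀ →
        ∀ U : (bg9YR (Matrix (Fin N) (Fin N) ℂ) G R₁ R₂ x).Cfg, (bg9YR (Matrix (Fin N) (Fin N) ℂ) G R₁ R₂ x).Reg335 c35 α₀ U →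
          Left342At x.toKIdx (𝔏 x).parS (𝔏 x).Gp U B₀ δ₀ := by
  obtain ⟨M₂, a₀, C, δ, hM₂, ha₀, hC, hδ, hmaj⟩ := h
  refine ⟨M₂, δ, min a₀ aK, max 1 (mN * C * Real.exp (2 * δ)), hM₂, hδ, lt_min ha₀ haK, lt_of_lt_of_le one_pos (le_max_left _ _),
    fun x hM α₀ hα₀ hMa U hU => ?_⟩
  obtain ⟨h0, h1⟩ := hmaj x hM α₀ hα₀ (hMa.trans (min_le_left _ _)) U hU
  -- the ONE transporter read: UNITARITY on the regime below the threshold, hence contractivity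
  have hpar : ∀ z w : SiteY x.toKIdx, ‖((𝔏 x).parS U z w : Matrix (Fin N) (Fin N) ℂ)‖ ≤ 1 ∧
      ‖((((𝔏 x).parS U z w)⁻¹ : (Matrix (Fin N) (Fin N) ℂ)ˣ) : Matrix (Fin N) (Fin N) ℂ)‖ ≤ 1 :=
    fun z w => contractive_of_mem (G := unitaryUnits (Matrix (Fin N) (Fin N) ℂ)) le_rfl
      (hparU x α₀ hα₀ (hMa.trans (min_le_right _ _)) U hU z w)
  have hL := left342At_of_hasMajorants (κ := κ) x b (B := bg9YR (Matrix (Fin N) (Fin N) ℂ) G R₁ R₂ x) (fun U => U) (𝔏 x).Gp (𝔏 x).parS U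
    (hlev x) (hβ1 x) (hnbr x) hpar hC hδ.le h0 h1
  exact left342At_mono hL (le_max_right _ _)

/-- **THE LEFT (3.42) SCHEMA AT THE CARRIER FROM ROW 18's LEAF OF THEOREM 3.7, UNDER THE UNITARITY LAW OF THE SITE TRANSPORTER** — for ANY
expansion family `E` whose convergence predicate yields n06-c's `Conv342 (𝔬 x) (R x) (H x) C δ` (`hconv`; e.g. the `PairM` ∕ `PairMDir` E-letters: first
conjunct of `ConvAll342`, `R = 1`, `C = p.C(…)`, `δ = (1 − 2p.α)p.δ₀`), the walk letters pinned to the coordinate models of `(𝔏 x).Gp` — n06-i's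
`majorants_of_thm37Printed_R` composed with §1's `…_lawU` (class-blind: no `G ≤ U(N)`, no `MemOfFam` needed here).
[cite: Balaban1985BackgroundPropagators, Thm 3.1 (3.42) p.397 ⇐ Thm 3.7 p.409–410; (3.19) p.393, (3.25) p.394, (3.35) p.396; Balaban1985Averaging, Prop. 2 p.26] -/
theorem thm31LeftSchemaR_of_t37_lawU
    (b : Module.Basis κ ℝ (Matrix (Fin N) (Fin N) ℂ)) {c35 : ℝ} (𝔏 : ∀ x : MemberY d ℓ hd hL b₀ b₁ Mstar, CovLettersY (Matrix (Fin N) (Fin N) ℂ) x)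
    {aK : ℝ} (haK : 0 < aK)
    (hparU : ∀ (x : MemberY d ℓ hd hL b₀ b₁ Mstar) (α₀ : ℝ), 0 < α₀ → (geo9Y x).M * α₀ ≤ aK →
      ∀ U : (bg9YR (Matrix (Fin N) (Fin N) ℂ) G R₁ R₂ x).Cfg, (bg9YR (Matrix (Fin N) (Fin N) ℂ) G R₁ R₂ x).Reg335 c35 α₀ U →
        ∀ z w : SiteY x.toKIdx, (𝔏 x).parS U z w ∈ unitaryUnits (Matrix (Fin N) (Fin N) ℂ))
    {bI : ∀ x : MemberY d ℓ hd hL b₀ b₁ Mstar, FBondY x.toKIdx → IBondY x.toKIdx}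
    (hlev : ∀ (x : MemberY d ℓ hd hL b₀ b₁ Mstar) (f : FBondY x.toKIdx), lvl x.hN x.D x.hk (bI x f) = (blkV1 x.hN x.D f).1.1)
    (hβ1 : ∀ (x : MemberY d ℓ hd hL b₀ b₁ Mstar) (f : FBondY x.toKIdx), (B6Geom246MultiLevelTorus.geomT x.D).dist (β x.hN x.D x.hk (bI x f)) (blkV1 x.hN x.D f) ≤ 1)
    {mN : ℕ} (hnbr : ∀ (x : MemberY d ℓ hd hL b₀ b₁ Mstar) (y : (geo9Y x).Site), (nbr (geo9Y x) 2 y).card ≤ mN)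
    {ι : MemberY d ℓ hd hL b₀ b₁ Mstar → Type}
    (𝔬 : ∀ x : MemberY d ℓ hd hL b₀ b₁ Mstar, Ops (geo9Y x) (bg9YR (Matrix (Fin N) (Fin N) ℂ) G R₁ R₂ x) (XSK κ x.toKIdx) (XSK κ x.toKIdx) (ι x))
    {E : ∀ x : MemberY d ℓ hd hL b₀ b₁ Mstar, B9.RWExpansion (geo9Y x) (bg9YR (Matrix (Fin N) (Fin N) ℂ) G R₁ R₂ x)}
    (t37 : B9.Thm37Printed c35 (fun x : MemberY d ℓ hd hL b₀ b₁ Mstar => geo9Y x) (fun x => bg9YR (Matrix (Fin N) (Fin N) ℂ) G R₁ R₂ x) E)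
    {R : MemberY d ℓ hd hL b₀ b₁ Mstar → ℝ} {H : MemberY d ℓ hd hL b₀ b₁ Mstar → Prop} {C δ : ℝ} (hC : 0 ≤ C) (hδ : 0 < δ)
    (hconv : ∀ (x : MemberY d ℓ hd hL b₀ b₁ Mstar) (U : (bg9YR (Matrix (Fin N) (Fin N) ℂ) G R₁ R₂ x).Cfg),
      (E x).Converges U → B9Thm37Whole.Conv342 (𝔬 x) (R x) (H x) C δ U)
    (hblkS : ∀ x : MemberY d ℓ hd hL b₀ b₁ Mstar, (𝔬 x).blk = blkSK x.toKIdx (sIK x.toKIdx (bI x)))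
    (hblkYS : ∀ x : MemberY d ℓ hd hL b₀ b₁ Mstar, (𝔬 x).blkY = blkSK x.toKIdx (sIK x.toKIdx (bI x)))
    (hGpS : ∀ (x : MemberY d ℓ hd hL b₀ b₁ Mstar) (U : (bg9YR (Matrix (Fin N) (Fin N) ℂ) G R₁ R₂ x).Cfg),
      (𝔬 x).Gp U = GcoS x.toKIdx b (bg9YR (Matrix (Fin N) (Fin N) ℂ) G R₁ R₂ x) (fun U => U) (𝔏 x).Gp U)
    (hDS : ∀ (x : MemberY d ℓ hd hL b₀ b₁ Mstar) (U : (bg9YR (Matrix (Fin N) (Fin N) ℂ) G R₁ R₂ x).Cfg),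
      (𝔬 x).D U = DcoS x.toKIdx b (bg9YR (Matrix (Fin N) (Fin N) ℂ) G R₁ R₂ x) (fun U => U) U) :
    ∃ M₁ δ₀ a₀ B₀ : ℝ, 0 < M₁ ∧ 0 < δ₀ ∧ 0 < a₀ ∧ 0 < B₀ ∧
      ∀ x : MemberY d ℓ hd hL b₀ b₁ Mstar, M₁ ≤ (geo9Y x).M → ∀ α₀ : ℝ, 0 < α₀ → (geo9Y x).M * α₀ ≤ a₀ →
        ∀ U : (bg9YR (Matrix (Fin N) (Fin N) ℂ) G R₁ R₂ x).Cfg, (bg9YR (Matrix (Fin N) (Fin N) ℂ) G R₁ R₂ x).Reg335 c35 α₀ U →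
          Left342At x.toKIdx (𝔏 x).parS (𝔏 x).Gp U B₀ δ₀ :=
  thm31LeftSchemaR_of_majorants_lawU R₁ R₂ b 𝔏 haK hparU hlev hβ1 hnbr
    (majorants_of_thm37Printed_R R₁ R₂ b 𝔏 𝔬 E t37 hC hδ hconv hblkS hblkYS hGpS hDS)

end Left

/-! ## §2 The symmetry ∕ unitarity conjuncts from the displayed law, and the adjoint side: `Thm31SiteSchemasR` -/

section Adjoint

variable {N : ℕ} {G : Subgroup (Matrix (Fin N) (Fin N) ℂ)ˣ}
variable {d ℓ : ℕ} {hd : 1 ≤ d + 1} {hL : Odd (ℓ + 1) ∧ 1 < ℓ + 1} {b₀ b₁ : ℝ} {Mstar : ℕ}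
variable (R₁ R₂ : RegFamY d ℓ hd hL b₀ b₁ Mstar (Matrix (Fin N) (Fin N) ℂ))

/-- **`LEFT → LEFT ∧ SYMMETRIC ∧ UNITARY LEGS` FROM THE DISPLAYED LAW** (threshold `min a₀ aK`): the law's two conjuncts are appended to the LEFT schema on the
common range — the law-generic twin of n06-i's `thm31LeftSchemaSymmR_of_std` (there: `isSymmTr_GpY_parSymY`, `parSymY_mem`).
[cite: Balaban1985BackgroundPropagators, (3.24)–(3.25) p.394, (3.35) p.396, (3.19) p.393; Balaban1985Averaging, Prop. 2 p.26] -/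
theorem thm31LeftSchemaSymmR_of_lawS (𝔏 : ∀ x : MemberY d ℓ hd hL b₀ b₁ Mstar, CovLettersY (Matrix (Fin N) (Fin N) ℂ) x) {c35 : ℝ}
    {aK : ℝ} (haK : 0 < aK)
    (hlawS : ∀ (x : MemberY d ℓ hd hL b₀ b₁ Mstar) (α₀ : ℝ), 0 < α₀ → (geo9Y x).M * α₀ ≤ aK →
      ∀ U : (bg9YR (Matrix (Fin N) (Fin N) ℂ) G R₁ R₂ x).Cfg, (bg9YR (Matrix (Fin N) (Fin N) ℂ) G R₁ R₂ x).Reg335 c35 α₀ U →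
        (∀ z w : SiteY x.toKIdx, (𝔏 x).parS U z w ∈ unitaryUnits (Matrix (Fin N) (Fin N) ℂ)) ∧ IsSymmTr (fun _ => (1 : ℝ)) ((𝔏 x).Gp U))
    (h : ∃ M₁ δ₀ a₀ B₀ : ℝ, 0 < M₁ ∧ 0 < δ₀ ∧ 0 < a₀ ∧ 0 < B₀ ∧
      ∀ x : MemberY d ℓ hd hL b₀ b₁ Mstar, M₁ ≤ (geo9Y x).M → ∀ α₀ : ℝ, 0 < α₀ → (geo9Y x).M * α₀ ≤ a₀ →
        ∀ U : (bg9YR (Matrix (Fin N) (Fin N) ℂ) G R₁ R₂ x).Cfg, (bg9YR (Matrix (Fin N) (Fin N) ℂ) G R₁ R₂ x).Reg335 c35 α₀ U →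
          Left342At x.toKIdx (𝔏 x).parS (𝔏 x).Gp U B₀ δ₀) :
    ∃ M₁ δ₀ a₀ B₀ : ℝ, 0 < M₁ ∧ 0 < δ₀ ∧ 0 < a₀ ∧ 0 < B₀ ∧
      ∀ x : MemberY d ℓ hd hL b₀ b₁ Mstar, M₁ ≤ (geo9Y x).M → ∀ α₀ : ℝ, 0 < α₀ → (geo9Y x).M * α₀ ≤ a₀ →
        ∀ U : (bg9YR (Matrix (Fin N) (Fin N) ℂ) G R₁ R₂ x).Cfg, (bg9YR (Matrix (Fin N) (Fin N) ℂ) G R₁ R₂ x).Reg335 c35 α₀ U →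
          Left342At x.toKIdx (𝔏 x).parS (𝔏 x).Gp U B₀ δ₀ ∧ IsSymmTr (fun _ => (1 : ℝ)) ((𝔏 x).Gp U) ∧
            ∀ z w : SiteY x.toKIdx, (𝔏 x).parS U z w ∈ unitaryUnits (Matrix (Fin N) (Fin N) ℂ) := by
  obtain ⟨M₁, δ₀, a₀, B₀, hM₁, hδ₀, ha₀, hB₀, H⟩ := h
  refine ⟨M₁, δ₀, min a₀ aK, B₀, hM₁, hδ₀, lt_min ha₀ haK, hB₀, fun x hM α₀ hα₀ hMa U hU => ?_⟩
  obtain ⟨hparU, hsymm⟩ := hlawS x α₀ hα₀ (hMa.trans (min_le_right _ _)) U hU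
  exact ⟨H x hM α₀ hα₀ (hMa.trans (min_le_left _ _)) U hU, hsymm, hparU⟩

/-- ★ **`Thm31SiteSchemasR` FROM THE LEFT ∧ SYMMETRIC ∧ UNITARY-LEGS SCHEMA AT THE CARRIER** (`G ≤ U(N)`; `U` is `G`-valued on the carrier's (3.35) by
`hGR : MemOfFam G R₁`): n06-i's `thm31SiteSchemasR_of_leftSymm` with the membership conjunct READ IN `U(N)` (all its proof uses); constant `max 1 N · B₀`, the
adjoint side by `right342At_of_left342At`. [cite: Balaban1985BackgroundPropagators, Thm 3.1 (3.42) p.397, (3.25) p.394, (3.35) p.396] -/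
theorem thm31SiteSchemasR_of_leftSymmU (hG : G ≤ unitaryUnits (Matrix (Fin N) (Fin N) ℂ)) (hGR : MemOfFam G R₁) {c35 : ℝ}
    (𝔏 : ∀ x : MemberY d ℓ hd hL b₀ b₁ Mstar, CovLettersY (Matrix (Fin N) (Fin N) ℂ) x)
    (h : ∃ M₁ δ₀ a₀ B₀ : ℝ, 0 < M₁ ∧ 0 < δ₀ ∧ 0 < a₀ ∧ 0 < B₀ ∧
      ∀ x : MemberY d ℓ hd hL b₀ b₁ Mstar, M₁ ≤ (geo9Y x).M → ∀ α₀ : ℝ, 0 < α₀ → (geo9Y x).M * α₀ ≤ a₀ →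
        ∀ U : (bg9YR (Matrix (Fin N) (Fin N) ℂ) G R₁ R₂ x).Cfg, (bg9YR (Matrix (Fin N) (Fin N) ℂ) G R₁ R₂ x).Reg335 c35 α₀ U →
          Left342At x.toKIdx (𝔏 x).parS (𝔏 x).Gp U B₀ δ₀ ∧ IsSymmTr (fun _ => (1 : ℝ)) ((𝔏 x).Gp U) ∧
            ∀ z w : SiteY x.toKIdx, (𝔏 x).parS U z w ∈ unitaryUnits (Matrix (Fin N) (Fin N) ℂ)) :
    Thm31SiteSchemasR (Matrix (Fin N) (Fin N) ℂ) G c35 𝔏 R₁ R₂ := by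
  obtain ⟨M₁, δ₀, a₀, B₀, hM₁, hδ₀, ha₀, hB₀, H⟩ := h
  refine ⟨M₁, δ₀, a₀, max 1 (N : ℝ) * B₀, hM₁, hδ₀, ha₀, by positivity, fun x hM α₀ hα₀ hMa U hU => ?_⟩
  obtain ⟨hLe, hsymm, hparU⟩ := H x hM α₀ hα₀ hMa U hU
  -- the ONE class read: `G`-valuedness of `U`, from the displayed `MemOfFam G R₁`; `G ≤ U(N)`
  have hUG : ∀ μ y, U μ y ∈ G := mem_of_reg335R hGR x hU
  have hUu : ∀ μ y, (U μ y : Matrix (Fin N) (Fin N) ℂ) ∈ unitary (Matrix (Fin N) (Fin N) ℂ) := fun μ y => hG (hUG μ y)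
  have hparu : ∀ (s : BlkY x.toKIdx) (z : SiteY x.toKIdx),
      ((𝔏 x).parS U (blkCornerY x.toKIdx s) z : Matrix (Fin N) (Fin N) ℂ) ∈ unitary (Matrix (Fin N) (Fin N) ℂ) :=
    fun s z => hparU _ z
  have hR := right342At_of_left342At x.toKIdx hUu hparu hsymm hB₀.le hLe
  -- monotonicity of both schemas in the constant: `B₀, N·B₀ ≤ max 1 N · B₀`
  have hle₁ : B₀ ≤ max 1 (N : ℝ) * B₀ := by nlinarith [le_max_left (1 : ℝ) N]
  have hle₂ : (N : ℝ) * B₀ ≤ max 1 (N : ℝ) * B₀ := mul_le_mul_of_nonneg_right (le_max_right _ _) hB₀.le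
  refine ⟨fun s s₁ F hF z hz => ⟨?_, fun μ => ?_⟩, fun s₂ s' x' hx' E hE => ⟨?_, fun ν => ?_⟩⟩
  · exact (hLe s s₁ F hF z hz).1.trans (by
      have := (lenB_pos x.toKIdx s).le
      exact mul_le_mul_of_nonneg_right (mul_le_mul_of_nonneg_right hle₁ (pow_nonneg this 2)) (Real.exp_nonneg _))
  · exact ((hLe s s₁ F hF z hz).2 μ).trans (by
      have := (lenB_pos x.toKIdx s).le
      exact mul_le_mul_of_nonneg_right (mul_le_mul_of_nonneg_right hle₁ this) (Real.exp_nonneg _))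
  · exact (hR s₂ s' x' hx' E hE).1.trans (by
      have := (lenB_pos x.toKIdx s').le
      exact mul_le_mul_of_nonneg_right (mul_le_mul_of_nonneg_right hle₂ (pow_nonneg this 2)) (Real.exp_nonneg _))
  · exact ((hR s₂ s' x' hx' E hE).2 ν).trans (by
      have := (lenB_pos x.toKIdx s').le
      exact mul_le_mul_of_nonneg_right (mul_le_mul_of_nonneg_right hle₂ this) (Real.exp_nonneg _))

variable {κ : Type} [Fintype κ] [DecidableEq κ]
variable [∀ x : MemberY d ℓ hd hL b₀ b₁ Mstar, Fintype (geo9Y x).Site]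

/-- ★★ **`Thm31SiteSchemasR (M_N(ℂ)) G c35 𝔏 R₁ R₂` FROM ROW 18's LEAF OF THEOREM 3.7 AND THE DISPLAYED TRANSPORTER LAW** (`G ≤ U(N)`,
`hGR : MemOfFam G R₁`; any expansion family `E` with `hconv`) — the law-generic twin of n06-i's `B9Ineq349SiteFacesAtLettersR.thm31SiteSchemasR_of_t37_pairM_of`
(§1 + §2 composed). [cite: Balaban1985BackgroundPropagators, Thm 3.1 (3.42)–(3.47) p.397–398 ⇐ Thm 3.7 p.409–410; (3.19) p.393, (3.24)–(3.25) p.394, (3.35) p.396; Balaban1985Averaging, Prop. 2 p.26] -/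
theorem thm31SiteSchemasR_of_t37_lawS (hG : G ≤ unitaryUnits (Matrix (Fin N) (Fin N) ℂ)) (hGR : MemOfFam G R₁)
    (b : Module.Basis κ ℝ (Matrix (Fin N) (Fin N) ℂ)) {c35 : ℝ} (𝔏 : ∀ x : MemberY d ℓ hd hL b₀ b₁ Mstar, CovLettersY (Matrix (Fin N) (Fin N) ℂ) x)
    {bI : ∀ x : MemberY d ℓ hd hL b₀ b₁ Mstar, FBondY x.toKIdx → IBondY x.toKIdx}
    (hlev : ∀ (x : MemberY d ℓ hd hL b₀ b₁ Mstar) (f : FBondY x.toKIdx), lvl x.hN x.D x.hk (bI x f) = (blkV1 x.hN x.D f).1.1)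
    (hβ1 : ∀ (x : MemberY d ℓ hd hL b₀ b₁ Mstar) (f : FBondY x.toKIdx), (B6Geom246MultiLevelTorus.geomT x.D).dist (β x.hN x.D x.hk (bI x f)) (blkV1 x.hN x.D f) ≤ 1)
    {mN : ℕ} (hnbr : ∀ (x : MemberY d ℓ hd hL b₀ b₁ Mstar) (y : (geo9Y x).Site), (nbr (geo9Y x) 2 y).card ≤ mN)
    {ι : MemberY d ℓ hd hL b₀ b₁ Mstar → Type}
    (𝔬 : ∀ x : MemberY d ℓ hd hL b₀ b₁ Mstar, Ops (geo9Y x) (bg9YR (Matrix (Fin N) (Fin N) ℂ) G R₁ R₂ x) (XSK κ x.toKIdx) (XSK κ x.toKIdx) (ι x))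
    {E : ∀ x : MemberY d ℓ hd hL b₀ b₁ Mstar, B9.RWExpansion (geo9Y x) (bg9YR (Matrix (Fin N) (Fin N) ℂ) G R₁ R₂ x)}
    (t37 : B9.Thm37Printed c35 (fun x : MemberY d ℓ hd hL b₀ b₁ Mstar => geo9Y x) (fun x => bg9YR (Matrix (Fin N) (Fin N) ℂ) G R₁ R₂ x) E)
    {R : MemberY d ℓ hd hL b₀ b₁ Mstar → ℝ} {H : MemberY d ℓ hd hL b₀ b₁ Mstar → Prop} {C δ : ℝ} (hC : 0 ≤ C) (hδ : 0 < δ)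
    (hconv : ∀ (x : MemberY d ℓ hd hL b₀ b₁ Mstar) (U : (bg9YR (Matrix (Fin N) (Fin N) ℂ) G R₁ R₂ x).Cfg),
      (E x).Converges U → B9Thm37Whole.Conv342 (𝔬 x) (R x) (H x) C δ U)
    (hblkS : ∀ x : MemberY d ℓ hd hL b₀ b₁ Mstar, (𝔬 x).blk = blkSK x.toKIdx (sIK x.toKIdx (bI x)))
    (hblkYS : ∀ x : MemberY d ℓ hd hL b₀ b₁ Mstar, (𝔬 x).blkY = blkSK x.toKIdx (sIK x.toKIdx (bI x)))
    (hGpS : ∀ (x : MemberY d ℓ hd hL b₀ b₁ Mstar) (U : (bg9YR (Matrix (Fin N) (Fin N) ℂ) G R₁ R₂ x).Cfg),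
      (𝔬 x).Gp U = GcoS x.toKIdx b (bg9YR (Matrix (Fin N) (Fin N) ℂ) G R₁ R₂ x) (fun U => U) (𝔏 x).Gp U)
    (hDS : ∀ (x : MemberY d ℓ hd hL b₀ b₁ Mstar) (U : (bg9YR (Matrix (Fin N) (Fin N) ℂ) G R₁ R₂ x).Cfg),
      (𝔬 x).D U = DcoS x.toKIdx b (bg9YR (Matrix (Fin N) (Fin N) ℂ) G R₁ R₂ x) (fun U => U) U)
    -- the transporter law on the regime below the threshold `aK` (NEW vs n06-i: replaces `hparS ∕ hGp`)
    {aK : ℝ} (haK : 0 < aK)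
    (hlawS : ∀ (x : MemberY d ℓ hd hL b₀ b₁ Mstar) (α₀ : ℝ), 0 < α₀ → (geo9Y x).M * α₀ ≤ aK →
      ∀ U : (bg9YR (Matrix (Fin N) (Fin N) ℂ) G R₁ R₂ x).Cfg, (bg9YR (Matrix (Fin N) (Fin N) ℂ) G R₁ R₂ x).Reg335 c35 α₀ U →
        (∀ z w : SiteY x.toKIdx, (𝔏 x).parS U z w ∈ unitaryUnits (Matrix (Fin N) (Fin N) ℂ)) ∧ IsSymmTr (fun _ => (1 : ℝ)) ((𝔏 x).Gp U)) :
    Thm31SiteSchemasR (Matrix (Fin N) (Fin N) ℂ) G c35 𝔏 R₁ R₂ :=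
  thm31SiteSchemasR_of_leftSymmU R₁ R₂ hG hGR _
    (thm31LeftSchemaSymmR_of_lawS R₁ R₂ 𝔏 haK hlawS
      (thm31LeftSchemaR_of_t37_lawU R₁ R₂ b 𝔏 haK (fun x α₀ hα ha U hU => (hlawS x α₀ hα ha U hU).1)
        hlev hβ1 hnbr 𝔬 t37 hC hδ hconv hblkS hblkYS hGpS hDS))

end Adjoint

/-! ## §3 ★★★ Row 25 of the R-generic certificate in one call, for any letters family obeying the displayed law -/

section Laws

variable {N : ℕ} {κ : Type} [Fintype κ] [DecidableEq κ]

/-- ★★★ **ROW 25 OF THE R-GENERIC N06 CERTIFICATE AT ANY LETTERS FAMILY WHOSE SITE TRANSPORTER OBEYS THE DISPLAYED LAW**: (3.49) for the genuine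
`P = I − R(U)` at the class-parametric carrier — `B9.Stmt349Printed (d+1) c35 geo9Y (bg9YR … R₁ R₂) (x ↦ fineKernelR R₁ R₂ (p349SiteY … x (𝔏 x)))` (the `s349`
slot, `= fineKernelR R₁ R₂ (ops x).P349` by `rfl` at every `opsYS349Nu…[H]` instance over `𝔏`) — from ROW 18's leaf `t37` on the `PairM` E-letter at the four site
pins over the carrier, ROWS 15–16's one display `h348` premised on the carrier's (3.35), the faithful block map (`hlev`, `hβ1`), the radius-2 count (`hnbr`), the
displayed `hGR : MemOfFam SU(N) R₁`, and the ONE displayed transporter LAW `hlawS` on the regime below `aK` (unitary values of `(𝔏 x).parS U`, trace-symmetry of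
`(𝔏 x).Gp U`) — n06-i's `B9Ineq349SiteFacesAtLettersR.s349_site_of_t37_display348_of_R` with `hparS hGp ↦ haK hlawS`, nothing else changed.
[cite: Balaban1985BackgroundPropagators, (3.49) p.399 («using again Lemma 2.1»); Thm 3.1 ⇐ Thm 3.7 p.410; Thm 3.2 ⇐ Thm 3.9 p.413 + (3.96) p.411; (3.19) p.393, (3.24)–(3.25) p.394, (3.35) p.396; Balaban1984PropagatorsII, Lemma 2.1 p.234, (2.51) p.232; Balaban1985Averaging, Prop. 2 p.26] -/
theorem s349_site_of_t37_display348_of_R_lawS (θ : Stage3Params) (Mstar : ℕ)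
    (R₁ R₂ : RegFamY θ.d₆ θ.ℓ₆ θ.hd' θ.hL' θ.b₀ θ.b₁ Mstar (Matrix (Fin N) (Fin N) ℂ)) (hGR : MemOfFam (specialUnitaryUnits (Fin N)) R₁)
    (𝔏 : LettersY N θ Mstar)
    [∀ x : MemberY θ.d₆ θ.ℓ₆ θ.hd' θ.hL' θ.b₀ θ.b₁ Mstar, Fintype (geo9Y x).Site] [∀ x : MemberY θ.d₆ θ.ℓ₆ θ.hd' θ.hL' θ.b₀ θ.b₁ Mstar, DecidableEq (geo9Y x).Site]
    (b : Module.Basis κ ℝ (Matrix (Fin N) (Fin N) ℂ)) {c35 : ℝ}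
    {bI : ∀ x : MemberY θ.d₆ θ.ℓ₆ θ.hd' θ.hL' θ.b₀ θ.b₁ Mstar, FBondY x.toKIdx → IBondY x.toKIdx}
    (hlev : ∀ (x : MemberY θ.d₆ θ.ℓ₆ θ.hd' θ.hL' θ.b₀ θ.b₁ Mstar) (f : FBondY x.toKIdx), lvl x.hN x.D x.hk (bI x f) = (blkV1 x.hN x.D f).1.1)
    (hβ1 : ∀ (x : MemberY θ.d₆ θ.ℓ₆ θ.hd' θ.hL' θ.b₀ θ.b₁ Mstar) (f : FBondY x.toKIdx),
      (B6Geom246MultiLevelTorus.geomT x.D).dist (β x.hN x.D x.hk (bI x f)) (blkV1 x.hN x.D f) ≤ 1)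
    {mN : ℕ} (hnbr : ∀ (x : MemberY θ.d₆ θ.ℓ₆ θ.hd' θ.hL' θ.b₀ θ.b₁ Mstar) (y : (geo9Y x).Site), (nbr (geo9Y x) 2 y).card ≤ mN)
    -- row 18: Theorem 3.7's leaf on the `PairM` E-letter at the site pins, over the carrier
    {ι : MemberY θ.d₆ θ.ℓ₆ θ.hd' θ.hL' θ.b₀ θ.b₁ Mstar → Type}
    (𝔬 : ∀ x : MemberY θ.d₆ θ.ℓ₆ θ.hd' θ.hL' θ.b₀ θ.b₁ Mstar, Ops (geo9Y x) (bg9YR (Matrix (Fin N) (Fin N) ℂ) (specialUnitaryUnits (Fin N)) R₁ R₂ x)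
      (XSK κ x.toKIdx) (XSK κ x.toKIdx) (ι x))
    (rd : ∀ x : MemberY θ.d₆ θ.ℓ₆ θ.hd' θ.hL' θ.b₀ θ.b₁ Mstar, WalkReading (geo9Y x) (bg9YR (Matrix (Fin N) (Fin N) ℂ) (specialUnitaryUnits (Fin N)) R₁ R₂ x)
      (XSK κ x.toKIdx) (ι x))
    (H : MemberY θ.d₆ θ.ℓ₆ θ.hd' θ.hL' θ.b₀ θ.b₁ Mstar → Prop) {m mN' : ℕ} {Cev NQ : ℝ} {p q : PinPrims} (hp : p.OK) {p3 q3 : PairPrims}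
    {pM qM : MixedPrims}
    {K : ∀ x : MemberY θ.d₆ θ.ℓ₆ θ.hd' θ.hL' θ.b₀ θ.b₁ Mstar, B9.KernelFamily (geo9Y x) (bg9YR (Matrix (Fin N) (Fin N) ℂ) (specialUnitaryUnits (Fin N)) R₁ R₂ x)}
    (t37 : B9.Thm37Printed c35 (fun x : MemberY θ.d₆ θ.ℓ₆ θ.hd' θ.hL' θ.b₀ θ.b₁ Mstar => geo9Y x)
      (fun x => bg9YR (Matrix (Fin N) (Fin N) ℂ) (specialUnitaryUnits (Fin N)) R₁ R₂ x)
      (fun x => E37YPairM (bg := bg9YR (Matrix (Fin N) (Fin N) ℂ) (specialUnitaryUnits (Fin N)) R₁ R₂) m mN' Cev NQ p q p3 q3 pM qM (𝔬 x) (rd x) (H x) (K x)))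
    (hblkS : ∀ x : MemberY θ.d₆ θ.ℓ₆ θ.hd' θ.hL' θ.b₀ θ.b₁ Mstar, (𝔬 x).blk = blkSK x.toKIdx (sIK x.toKIdx (bI x)))
    (hblkYS : ∀ x : MemberY θ.d₆ θ.ℓ₆ θ.hd' θ.hL' θ.b₀ θ.b₁ Mstar, (𝔬 x).blkY = blkSK x.toKIdx (sIK x.toKIdx (bI x)))
    (hGpS : ∀ (x : MemberY θ.d₆ θ.ℓ₆ θ.hd' θ.hL' θ.b₀ θ.b₁ Mstar) (U : (bg9YR (Matrix (Fin N) (Fin N) ℂ) (specialUnitaryUnits (Fin N)) R₁ R₂ x).Cfg),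
      (𝔬 x).Gp U = GcoS x.toKIdx b (bg9YR (Matrix (Fin N) (Fin N) ℂ) (specialUnitaryUnits (Fin N)) R₁ R₂ x) (fun U => U) (𝔏 x).Gp U)
    (hDS : ∀ (x : MemberY θ.d₆ θ.ℓ₆ θ.hd' θ.hL' θ.b₀ θ.b₁ Mstar) (U : (bg9YR (Matrix (Fin N) (Fin N) ℂ) (specialUnitaryUnits (Fin N)) R₁ R₂ x).Cfg),
      (𝔬 x).D U = DcoS x.toKIdx b (bg9YR (Matrix (Fin N) (Fin N) ℂ) (specialUnitaryUnits (Fin N)) R₁ R₂ x) (fun U => U) U)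
    -- the transporter law on the regime below the threshold `aK` (NEW vs n06-i's `…_of_R`: replaces the pins `hparS ∕ hGp` to `parSymY`)
    {aK : ℝ} (haK : 0 < aK)
    (hlawS : ∀ (x : MemberY θ.d₆ θ.ℓ₆ θ.hd' θ.hL' θ.b₀ θ.b₁ Mstar) (α₀ : ℝ), 0 < α₀ → (geo9Y x).M * α₀ ≤ aK →
      ∀ U : (bg9YR (Matrix (Fin N) (Fin N) ℂ) (specialUnitaryUnits (Fin N)) R₁ R₂ x).Cfg,
        (bg9YR (Matrix (Fin N) (Fin N) ℂ) (specialUnitaryUnits (Fin N)) R₁ R₂ x).Reg335 c35 α₀ U →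
          (∀ z w : SiteY x.toKIdx, (𝔏 x).parS U z w ∈ unitaryUnits (Matrix (Fin N) (Fin N) ℂ)) ∧ IsSymmTr (fun _ => (1 : ℝ)) ((𝔏 x).Gp U))
    -- rows 15–16: the one display `(3.48)⁻¹` on the faithful one-cube letters over `𝔏`, premised on the carrier's (3.35)
    (hc : 0 < c35) {B₁ δ₁ a₁ M₁ : ℝ} (hB : 0 ≤ B₁) (hδ : 0 < δ₁) (ha₁ : 0 < a₁) (hM₁ : 0 < M₁)
    (h348 : ∀ x : MemberY θ.d₆ θ.ℓ₆ θ.hd' θ.hL' θ.b₀ θ.b₁ Mstar, M₁ ≤ (geo9Y x).M → ∀ α₀ : ℝ, 0 < α₀ → c35 * (geo9Y x).M * α₀ ≤ a₁ →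
      ∀ U : (bg9YR (Matrix (Fin N) (Fin N) ℂ) (specialUnitaryUnits (Fin N)) R₁ R₂ x).Cfg,
        (bg9YR (Matrix (Fin N) (Fin N) ℂ) (specialUnitaryUnits (Fin N)) R₁ R₂ x).Reg335 c35 α₀ U → Conv348Blk (oneCubeOps39YF θ Mstar 𝔏 bI x) B₁ δ₁ U) :
    B9.Stmt349Printed (θ.d₆ + 1) c35 (geo9Y (d := θ.d₆) (ℓ := θ.ℓ₆) (hd := θ.hd') (hL := θ.hL') (b₀ := θ.b₀) (b₁ := θ.b₁) (Mstar := Mstar))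
      (bg9YR (Matrix (Fin N) (Fin N) ℂ) (specialUnitaryUnits (Fin N)) R₁ R₂)
      (fun x => fineKernelR R₁ R₂ (p349SiteY (Matrix (Fin N) (Fin N) ℂ) (specialUnitaryUnits (Fin N)) x (𝔏 x))) :=
  stmt349Printed_site_of_blockSchemas_R 𝔏 R₁ R₂
    (thm31SiteSchemasR_of_t37_lawS R₁ R₂ specialUnitaryUnits_le_unitaryUnits hGR b 𝔏 hlev hβ1 hnbr 𝔬 t37 (R := fun _ => (1 : ℝ)) (H := H)
      (p.C_nonneg hp _) (PinPrims.rate_pos hp) (fun _ _ h => h.1) hblkS hblkYS hGpS hDS haK hlawS)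
    (thm32BlkSchemaR_of_display348 θ Mstar 𝔏 R₁ R₂ bI hlev hβ1 hc hB hδ ha₁ hM₁ h348)

end Laws

/-! ## §4 ★★★ Row 25 keyed to print's KNIT averaging contours: the `s349K` binder of the knit certificate in one call -/

section Knit

variable {N : ℕ} {κ : Type} [Fintype κ] [DecidableEq κ]

/-- **ROWS 15–16's ONE DISPLAY WITH THE AVERAGING TRANSPORTER OF `L = Q′G′²Q′*` EXPLICIT, RE-THRESHOLDED** (the display shape of `B9Thm39FacesAtLettersRCPar` and of the
knit skeleton `…KnitPairKA`: `bg9YR`-typed one-cube ops, `L39 x (parA x) (𝔏 x).Gp`), at letters with `(𝔏 x).parS = parA x`: `Conv348Blk` IS a two-sided inverse of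
`L39 (𝔏 x).parS (𝔏 x).Gp U` with the block majorant `B₁(Lʲη)⁻⁴e^{−δ₁d}` w.r.t. `blk39F (bI x)`; `c35·M·α₀ ≤ a₁` becomes `M·α₀ ≤ a₁∕c35` — the `parA`-explicit twin of
n06-i's `B9Ineq349SiteSchemasR.majorants348_of_display348_R`. [cite: Balaban1985BackgroundPropagators, Thm 3.2 (3.48) p.398 + (3.95)–(3.96) p.411, (3.19) p.393, (3.35) p.396; Balaban1984PropagatorsII, (2.51) p.232] -/
theorem majorants348_of_display348_R_at (θ : Stage3Params) (Mstar : ℕ) (𝔏 : LettersY N θ Mstar)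
    (R₁ R₂ : RegFamY θ.d₆ θ.ℓ₆ θ.hd' θ.hL' θ.b₀ θ.b₁ Mstar (Matrix (Fin N) (Fin N) ℂ))
    [∀ x : MemberY θ.d₆ θ.ℓ₆ θ.hd' θ.hL' θ.b₀ θ.b₁ Mstar, Fintype (geo9Y x).Site]
    (bI : ∀ x : MemberY θ.d₆ θ.ℓ₆ θ.hd' θ.hL' θ.b₀ θ.b₁ Mstar, FBondY x.toKIdx → IBondY x.toKIdx)
    (parA : ∀ x : MemberY θ.d₆ θ.ℓ₆ θ.hd' θ.hL' θ.b₀ θ.b₁ Mstar, SiteParY (Matrix (Fin N) (Fin N) ℂ) x.toKIdx)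
    (hparS : ∀ x : MemberY θ.d₆ θ.ℓ₆ θ.hd' θ.hL' θ.b₀ θ.b₁ Mstar, (𝔏 x).parS = parA x)
    {c35 : ℝ} (hc : 0 < c35) {B₁ δ₁ a₁ M₁ : ℝ} (hB : 0 ≤ B₁) (hδ : 0 < δ₁) (ha₁ : 0 < a₁) (hM₁ : 0 < M₁)
    (h348 : ∀ x : MemberY θ.d₆ θ.ℓ₆ θ.hd' θ.hL' θ.b₀ θ.b₁ Mstar, M₁ ≤ (geo9Y x).M → ∀ α₀ : ℝ, 0 < α₀ → c35 * (geo9Y x).M * α₀ ≤ a₁ →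
      ∀ U : (bg9YR (Matrix (Fin N) (Fin N) ℂ) (specialUnitaryUnits (Fin N)) R₁ R₂ x).Cfg,
        (bg9YR (Matrix (Fin N) (Fin N) ℂ) (specialUnitaryUnits (Fin N)) R₁ R₂ x).Reg335 c35 α₀ U →
          Conv348Blk (oneCubeOps39 (geo9Y x) (bg9YR (Matrix (Fin N) (Fin N) ℂ) (specialUnitaryUnits (Fin N)) R₁ R₂ x)
            (blk39F (Matrix (Fin N) (Fin N) ℂ) x.toKIdx (bI x)) (L39 x.toKIdx (parA x) (𝔏 x).Gp)) B₁ δ₁ U) :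
    ∃ M₂ a₀ B₁ δ₁ : ℝ, 0 < M₂ ∧ 0 < a₀ ∧ 0 ≤ B₁ ∧ 0 < δ₁ ∧
      ∀ x : MemberY θ.d₆ θ.ℓ₆ θ.hd' θ.hL' θ.b₀ θ.b₁ Mstar, M₂ ≤ (geo9Y x).M → ∀ α₀ : ℝ, 0 < α₀ → (geo9Y x).M * α₀ ≤ a₀ →
        ∀ U : (bg9YR (Matrix (Fin N) (Fin N) ℂ) (specialUnitaryUnits (Fin N)) R₁ R₂ x).Cfg,
          (bg9YR (Matrix (Fin N) (Fin N) ℂ) (specialUnitaryUnits (Fin N)) R₁ R₂ x).Reg335 c35 α₀ U →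
          ∃ T : Module.End ℝ (X39 (Matrix (Fin N) (Fin N) ℂ) x.toKIdx → ℝ),
            T * L39 x.toKIdx (𝔏 x).parS (𝔏 x).Gp U = 1 ∧ L39 x.toKIdx (𝔏 x).parS (𝔏 x).Gp U * T = 1 ∧
            HasMajorant (g := toB6 (geo9Y x) 0 True) (blk39F (Matrix (Fin N) (Fin N) ℂ) x.toKIdx (bI x)) T
              (fun a a' => B₁ * (geo9Y x).len a ^ (-(4 : ℝ)) * Real.exp (-(δ₁ * (geo9Y x).dist a a'))) := by
  refine ⟨M₁, a₁ / c35, B₁, δ₁, hM₁, div_pos ha₁ hc, hB, hδ, fun x hM α₀ hα₀ hMa U hU => ?_⟩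
  have hMa' : c35 * (geo9Y x).M * α₀ ≤ a₁ := by
    rw [mul_assoc]
    calc c35 * ((geo9Y x).M * α₀) ≤ c35 * (a₁ / c35) := mul_le_mul_of_nonneg_left hMa hc.le
      _ = a₁ := mul_div_cancel₀ a₁ hc.ne'
  obtain ⟨T, hTL, hLT, hm⟩ := h348 x hM α₀ hα₀ hMa' U hU
  rw [hparS x]
  exact ⟨T, hTL, hLT, hm⟩

/-- ★★★ **ROW 25 OF THE N06 CERTIFICATE AT THE KNIT LETTERS IN ONE CALL** — (3.49) for the genuine `P = I − R(U)`, `R = G′(U; parKnitY)·Q′*(parKnitY)·a`, over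
print's KNIT averaging contours ([5] Prop. 2) at the class-parametric carrier: `B9.Stmt349Printed (d+1) c35 geo9Y (bg9YR … R₁ R₂) (x ↦ fineKernelR R₁ R₂
(p349SiteY … x (𝔏 x)))` — the `s349K` binder of `BalabanUVNodes.N06AtOpsYSectEStKnitPairKA.b9LeafXUR_opsYSectESt_knit_pairKA` … `…KnitRecordKE6X` (`rfl`:
`Node00.OpsYRecordV11SH.opsYS349NuOfLettersH_P349`) — for ANY letters family with the two knit pins `(𝔏 x).parS = parKnitY`, `(𝔏 x).Gp = GpY (parKnitY)` (closed
by `rfl` at `lettersYOfRecordV11K … 𝔯`), from: ROW 18's leaf `t37` on the `PairM` E-letter at the site pins (the skeleton's `t37'` on `E37YPairMDir …` inhabits it by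
`rfl` on `.Converges`), the skeleton's law «the knit legs are unitary on the regime below `aK`» (`hlawK … .1`: `laws_parKnitY_of_reg335P`), ROWS 15–16's display
`h348` at `L = Q′(parKnitY)G′²Q′*(parKnitY)` in the skeleton's currency, `hlev hβ1 hnbr`, `hGR : MemOfFam SU(N) R₁`.  The trace-symmetry of `G′(U; parKnitY) =
(Δ′_a(U; parKnitY))⁻¹` is DERIVED (dag-n06-l's `symm0`: `deltaPrimeAY_isSymmTr_of_inv_symm` at `parKnitY_inv`, then `isSymmTr_ringInverse`; `U` unitary on (3.35) by
`mem_of_reg335R hGR`).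
[cite: Balaban1985BackgroundPropagators, (3.49) p.399 («using again Lemma 2.1»); Thm 3.1 ⇐ Thm 3.7 p.410; Thm 3.2 ⇐ Thm 3.9 p.413 + (3.95)–(3.96) p.411; (3.19) p.393, (3.24)–(3.25) p.394, (3.35) p.396; Balaban1985Averaging, Prop. 2 p.26, (52)–(53) p.26; Balaban1984PropagatorsII, Lemma 2.1 p.234, (2.51) p.232] -/
theorem s349_site_of_t37_display348_of_R_knit (θ : Stage3Params) (Mstar : ℕ)
    (R₁ R₂ : RegFamY θ.d₆ θ.ℓ₆ θ.hd' θ.hL' θ.b₀ θ.b₁ Mstar (Matrix (Fin N) (Fin N) ℂ)) (hGR : MemOfFam (specialUnitaryUnits (Fin N)) R₁)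
    (𝔏 : LettersY N θ Mstar)
    (hparS : ∀ x : MemberY θ.d₆ θ.ℓ₆ θ.hd' θ.hL' θ.b₀ θ.b₁ Mstar, (𝔏 x).parS = parKnitY x.toKIdx)
    (hGp : ∀ x : MemberY θ.d₆ θ.ℓ₆ θ.hd' θ.hL' θ.b₀ θ.b₁ Mstar, (𝔏 x).Gp = GpY x.toKIdx (parKnitY x.toKIdx))
    [∀ x : MemberY θ.d₆ θ.ℓ₆ θ.hd' θ.hL' θ.b₀ θ.b₁ Mstar, Fintype (geo9Y x).Site] [∀ x : MemberY θ.d₆ θ.ℓ₆ θ.hd' θ.hL' θ.b₀ θ.b₁ Mstar, DecidableEq (geo9Y x).Site]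
    (b : Module.Basis κ ℝ (Matrix (Fin N) (Fin N) ℂ)) {c35 : ℝ}
    {bI : ∀ x : MemberY θ.d₆ θ.ℓ₆ θ.hd' θ.hL' θ.b₀ θ.b₁ Mstar, FBondY x.toKIdx → IBondY x.toKIdx}
    (hlev : ∀ (x : MemberY θ.d₆ θ.ℓ₆ θ.hd' θ.hL' θ.b₀ θ.b₁ Mstar) (f : FBondY x.toKIdx), lvl x.hN x.D x.hk (bI x f) = (blkV1 x.hN x.D f).1.1)
    (hβ1 : ∀ (x : MemberY θ.d₆ θ.ℓ₆ θ.hd' θ.hL' θ.b₀ θ.b₁ Mstar) (f : FBondY x.toKIdx),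
      (B6Geom246MultiLevelTorus.geomT x.D).dist (β x.hN x.D x.hk (bI x f)) (blkV1 x.hN x.D f) ≤ 1)
    {mN : ℕ} (hnbr : ∀ (x : MemberY θ.d₆ θ.ℓ₆ θ.hd' θ.hL' θ.b₀ θ.b₁ Mstar) (y : (geo9Y x).Site), (nbr (geo9Y x) 2 y).card ≤ mN)
    -- row 18: Theorem 3.7's leaf over the carrier on ANY expansion family `E` whose convergence yields `Conv342 (𝔬 x) (R x) (H x) C δ` (the skeleton's
    -- `t37'` on `E37YPairMDir …`: `hC := p.C_nonneg hp _`, `hδ := PinPrims.rate_pos hp`, `hconv := fun _ _ h => h.1`), walk letters at the site pins of `(𝔏 x).Gp`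
    {ι : MemberY θ.d₆ θ.ℓ₆ θ.hd' θ.hL' θ.b₀ θ.b₁ Mstar → Type}
    (𝔬 : ∀ x : MemberY θ.d₆ θ.ℓ₆ θ.hd' θ.hL' θ.b₀ θ.b₁ Mstar, Ops (geo9Y x) (bg9YR (Matrix (Fin N) (Fin N) ℂ) (specialUnitaryUnits (Fin N)) R₁ R₂ x)
      (XSK κ x.toKIdx) (XSK κ x.toKIdx) (ι x))
    {E : ∀ x : MemberY θ.d₆ θ.ℓ₆ θ.hd' θ.hL' θ.b₀ θ.b₁ Mstar, B9.RWExpansion (geo9Y x) (bg9YR (Matrix (Fin N) (Fin N) ℂ) (specialUnitaryUnits (Fin N)) R₁ R₂ x)}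
    (t37 : B9.Thm37Printed c35 (fun x : MemberY θ.d₆ θ.ℓ₆ θ.hd' θ.hL' θ.b₀ θ.b₁ Mstar => geo9Y x)
      (fun x => bg9YR (Matrix (Fin N) (Fin N) ℂ) (specialUnitaryUnits (Fin N)) R₁ R₂ x) E)
    {R : MemberY θ.d₆ θ.ℓ₆ θ.hd' θ.hL' θ.b₀ θ.b₁ Mstar → ℝ} {H : MemberY θ.d₆ θ.ℓ₆ θ.hd' θ.hL' θ.b₀ θ.b₁ Mstar → Prop} {C δ : ℝ} (hC : 0 ≤ C) (hδ0 : 0 < δ)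
    (hconv : ∀ (x : MemberY θ.d₆ θ.ℓ₆ θ.hd' θ.hL' θ.b₀ θ.b₁ Mstar) (U : (bg9YR (Matrix (Fin N) (Fin N) ℂ) (specialUnitaryUnits (Fin N)) R₁ R₂ x).Cfg),
      (E x).Converges U → B9Thm37Whole.Conv342 (𝔬 x) (R x) (H x) C δ U)
    (hblkS : ∀ x : MemberY θ.d₆ θ.ℓ₆ θ.hd' θ.hL' θ.b₀ θ.b₁ Mstar, (𝔬 x).blk = blkSK x.toKIdx (sIK x.toKIdx (bI x)))
    (hblkYS : ∀ x : MemberY θ.d₆ θ.ℓ₆ θ.hd' θ.hL' θ.b₀ θ.b₁ Mstar, (𝔬 x).blkY = blkSK x.toKIdx (sIK x.toKIdx (bI x)))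
    (hGpS : ∀ (x : MemberY θ.d₆ θ.ℓ₆ θ.hd' θ.hL' θ.b₀ θ.b₁ Mstar) (U : (bg9YR (Matrix (Fin N) (Fin N) ℂ) (specialUnitaryUnits (Fin N)) R₁ R₂ x).Cfg),
      (𝔬 x).Gp U = GcoS x.toKIdx b (bg9YR (Matrix (Fin N) (Fin N) ℂ) (specialUnitaryUnits (Fin N)) R₁ R₂ x) (fun U => U) (𝔏 x).Gp U)
    (hDS : ∀ (x : MemberY θ.d₆ θ.ℓ₆ θ.hd' θ.hL' θ.b₀ θ.b₁ Mstar) (U : (bg9YR (Matrix (Fin N) (Fin N) ℂ) (specialUnitaryUnits (Fin N)) R₁ R₂ x).Cfg),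
      (𝔬 x).D U = DcoS x.toKIdx b (bg9YR (Matrix (Fin N) (Fin N) ℂ) (specialUnitaryUnits (Fin N)) R₁ R₂ x) (fun U => U) U)
    -- the knit law on the regime below the plaquette threshold `aK`: the knit legs are unitary (the skeleton's `hlawK … .1`)
    {aK : ℝ} (haK : 0 < aK)
    (hlawK : ∀ (x : MemberY θ.d₆ θ.ℓ₆ θ.hd' θ.hL' θ.b₀ θ.b₁ Mstar) (α₀ : ℝ), 0 < α₀ → (geo9Y x).M * α₀ ≤ aK →
      ∀ U : (bg9YR (Matrix (Fin N) (Fin N) ℂ) (specialUnitaryUnits (Fin N)) R₁ R₂ x).Cfg,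
        (bg9YR (Matrix (Fin N) (Fin N) ℂ) (specialUnitaryUnits (Fin N)) R₁ R₂ x).Reg335 c35 α₀ U →
          ∀ z w : SiteY x.toKIdx, parKnitY x.toKIdx U z w ∈ unitaryUnits (Matrix (Fin N) (Fin N) ℂ))
    -- rows 15–16: the one display `(3.48)⁻¹` at `L = Q′(parKnitY)G′²Q′*(parKnitY)` on the faithful one-cube letters (the skeleton's `h348`)
    (hc : 0 < c35) {B₁ δ₁ a₁ M₁ : ℝ} (hB : 0 ≤ B₁) (hδ : 0 < δ₁) (ha₁ : 0 < a₁) (hM₁ : 0 < M₁)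
    (h348 : ∀ x : MemberY θ.d₆ θ.ℓ₆ θ.hd' θ.hL' θ.b₀ θ.b₁ Mstar, M₁ ≤ (geo9Y x).M → ∀ α₀ : ℝ, 0 < α₀ → c35 * (geo9Y x).M * α₀ ≤ a₁ →
      ∀ U : (bg9YR (Matrix (Fin N) (Fin N) ℂ) (specialUnitaryUnits (Fin N)) R₁ R₂ x).Cfg,
        (bg9YR (Matrix (Fin N) (Fin N) ℂ) (specialUnitaryUnits (Fin N)) R₁ R₂ x).Reg335 c35 α₀ U →
          Conv348Blk (oneCubeOps39 (geo9Y x) (bg9YR (Matrix (Fin N) (Fin N) ℂ) (specialUnitaryUnits (Fin N)) R₁ R₂ x)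
            (blk39F (Matrix (Fin N) (Fin N) ℂ) x.toKIdx (bI x)) (L39 x.toKIdx (parKnitY x.toKIdx) (𝔏 x).Gp)) B₁ δ₁ U) :
    B9.Stmt349Printed (θ.d₆ + 1) c35 (geo9Y (d := θ.d₆) (ℓ := θ.ℓ₆) (hd := θ.hd') (hL := θ.hL') (b₀ := θ.b₀) (b₁ := θ.b₁) (Mstar := Mstar))
      (bg9YR (Matrix (Fin N) (Fin N) ℂ) (specialUnitaryUnits (Fin N)) R₁ R₂)
      (fun x => fineKernelR R₁ R₂ (p349SiteY (Matrix (Fin N) (Fin N) ℂ) (specialUnitaryUnits (Fin N)) x (𝔏 x))) := by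
  -- the displayed law of §3 at the knit pins: unitarity is `hlawK`; the symmetry of `G′(U; parKnitY)` is derived
  have hlawS : ∀ (x : MemberY θ.d₆ θ.ℓ₆ θ.hd' θ.hL' θ.b₀ θ.b₁ Mstar) (α₀ : ℝ), 0 < α₀ → (geo9Y x).M * α₀ ≤ aK →
      ∀ U : (bg9YR (Matrix (Fin N) (Fin N) ℂ) (specialUnitaryUnits (Fin N)) R₁ R₂ x).Cfg,
        (bg9YR (Matrix (Fin N) (Fin N) ℂ) (specialUnitaryUnits (Fin N)) R₁ R₂ x).Reg335 c35 α₀ U →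
          (∀ z w : SiteY x.toKIdx, (𝔏 x).parS U z w ∈ unitaryUnits (Matrix (Fin N) (Fin N) ℂ)) ∧ IsSymmTr (fun _ => (1 : ℝ)) ((𝔏 x).Gp U) := by
    intro x α₀ hα₀ hMa U hU
    have hpar := hlawK x α₀ hα₀ hMa U hU
    have hUu : ∀ μ y, U μ y ∈ unitaryUnits (Matrix (Fin N) (Fin N) ℂ) :=
      fun μ y => specialUnitaryUnits_le_unitaryUnits (mem_of_reg335R hGR x hU μ y)
    refine ⟨fun z w => by rw [hparS x]; exact hpar z w, ?_⟩
    rw [hGp x]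
    exact isSymmTr_ringInverse _
      (deltaPrimeAY_isSymmTr_of_inv_symm x.toKIdx le_rfl (parKnitY x.toKIdx) U (parKnitY_inv x.toKIdx U) hpar hUu)
  exact stmt349Printed_site_of_blockSchemas_R 𝔏 R₁ R₂
    (thm31SiteSchemasR_of_t37_lawS R₁ R₂ specialUnitaryUnits_le_unitaryUnits hGR b 𝔏 hlev hβ1 hnbr 𝔬 t37 hC hδ0 hconv hblkS hblkYS hGpS hDS
      haK hlawS)
    (thm32BlkSchemaR_of_majorants R₁ R₂ 𝔏 hlev hβ1
      (majorants348_of_display348_R_at θ Mstar 𝔏 R₁ R₂ bI (fun x => parKnitY x.toKIdx) hparS hc hB hδ ha₁ hM₁ h348))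

end Knit

end Literature.MathematicalPhysics.QuantumFieldTheory.Balaban1983to89.B9Ineq349SiteFacesAtLettersRLaws

end
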